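import Literature.NumberTheory.DiophantineGeometry.Matveev2000Thm22OfThm21
import HarnessLib

/-!
# Cell abc-stewartyu — draft route `YuMatveevShapeRat` (plan-m3 g2, HOME/plan-m3/next/SketchGA.lean):
# the archimedean DEPENDENCE-REMOVAL step in SHAPE form (`∃ c, cⁿ`), proved

Cell `abc-stewartyu` (HOME `run/shared/lean/pub/abc-stewartyu/`; seat `lit-abc-yu2007` g3). Theorems only; no
definition, no named fact, nothing closed. `archShape_dep_of_indep`: if, for some real `c`, the shape bound
`log|∑ bᵢ log aᵢ| ≥ −cʳ ∏Aᵢ log(eB)` holds for all MULTIPLICATIVELY INDEPENDENT positive rationals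
`a : Fin r → ℚ` (`h(aᵢ) ≤ Aᵢ`, `1 ≤ Aᵢ`, `b ≠ 0`, `|bᵢ| ≤ B`) — the planner's text of the crux `ArchCoreRat`,
verbatim — then with `c' = max |c| 20` it holds for ALL positive rationals whenever the linear form is
non-zero: the "dependence removal" ingredient of the draft item `ArchShapeChain : ArchCoreRat → ArchHalf`.
Method = Matveev 2000 §21 ("исключение зависимых логарифмов") in shape currency, i.e. the argument of
`Literature/…/Matveev2000Thm22OfThm21.lean` with an unweighted `B`: strong induction on the number of
logarithms; Liouville (`log|Λ| ≥ −∑|bₖ|h(aₖ) ≥ −B n A_max`) either settles the bound or gives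
(†) `cⁿ ∏_{k≠k*} Aₖ log(eB) < nB` for an index `k*` of maximal weight; a dependence yields a small relation
`∏ aₖ^{2tₖ} = 1` on a minimal support `S`, `|tₖ| ≤ ∏_{l∈S∖k} 2h(a_l)/log 2` (`exists_small_mult_relation`);
the index eliminated is `k*` if `k* ∈ S`, else any `j ∈ S`, so that `R = 2∏_{l∈S∖j} 3A_l < B` by (†); the new
form is `2tⱼΛ` with `|b'ₖ| ≤ 2RAⱼB`, so `log(eB') ≤ 2log(eB) + log Aⱼ`, the `log Aⱼ` being paid by the freed
factor `Aⱼ` (Matveev p. 174, "`x ln(b/x)`"). WHAT THIS IS NOT: no analytic estimate (the hypothesis is the XL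
crux); no crux moved; no abc claim. References: [Matveev2000] Izv. Math. 64 (2000) 1217–1269, §21
(pp. 173–177); [Nesterenko2003] LNM 1819, Thm. 2.1/2.2 (the independent-logarithm archimedean core).
-/

open Height Real Finset
open Literature.NumberTheory.DiophantineGeometry.Dioph

noncomputable section

namespace Summit.ABC.StewartYu

namespace ArchShapeDepElim

/-- Sums over `{k // k ≠ j}` are sums over `univ.erase j`. [folklore] -/
private theorem sum_subtype_ne {κ : Type} [Fintype κ] [DecidableEq κ] (j : κ) (f : κ → ℝ) :
    ∑ k : {k // k ≠ j}, f k.val = ∑ k ∈ univ.erase j, f k :=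
  (Finset.sum_subtype (univ.erase j) (p := fun k => k ≠ j) (fun k => by simp) f).symm

/-- Products over `{k // k ≠ j}` are products over `univ.erase j`. [folklore] -/
private theorem prod_subtype_ne {κ : Type} [Fintype κ] [DecidableEq κ] (j : κ) (f : κ → ℝ) :
    ∏ k : {k // k ≠ j}, f k.val = ∏ k ∈ univ.erase j, f k :=
  (Finset.prod_subtype (univ.erase j) (p := fun k => k ≠ j) (fun k => by simp) f).symm

/-- `#{k // k ≠ j} = #κ − 1`. [folklore] -/
private theorem card_subtype_ne {κ : Type} [Fintype κ] [DecidableEq κ] (j : κ) {m : ℕ}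
    (hcard : Fintype.card κ = m + 1) : Fintype.card {k // k ≠ j} = m := by
  rw [Fintype.card_of_subtype (univ.erase j) (fun k => by simp), Finset.card_erase_of_mem
    (mem_univ j), card_univ, hcard]
  rfl

/-- If `∑ rₖ log aₖ = 0` then `∑_{k ≠ j} (rⱼ bₖ − rₖ bⱼ) log aₖ = rⱼ · ∑ bₖ log aₖ`.
[cite: Matveev2000, §21 (p. 174–175)] -/
private theorem sum_elim {κ : Type} [Fintype κ] [DecidableEq κ] (a : κ → ℚ) (b r : κ → ℤ) (j : κ)
    (hr : ∑ k, (r k : ℝ) * Real.log (a k : ℝ) = 0) :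
    ∑ k : {k // k ≠ j}, ((r j * b k.val - r k.val * b j : ℤ) : ℝ) * Real.log (a k.val : ℝ) =
      (r j : ℝ) * ∑ k, (b k : ℝ) * Real.log (a k : ℝ) := by
  rw [sum_subtype_ne j (fun k => ((r j * b k - r k * b j : ℤ) : ℝ) * Real.log (a k : ℝ))]
  have hj : ((r j * b j - r j * b j : ℤ) : ℝ) * Real.log (a j : ℝ) = 0 := by push_cast; ring
  rw [Finset.sum_erase (f := fun k => ((r j * b k - r k * b j : ℤ) : ℝ) * Real.log (a k : ℝ)) univ hj]
  have hk : ∀ k, ((r j * b k - r k * b j : ℤ) : ℝ) * Real.log (a k : ℝ) =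
      (r j : ℝ) * ((b k : ℝ) * Real.log (a k : ℝ)) - (b j : ℝ) * ((r k : ℝ) * Real.log (a k : ℝ)) := by
    intro k; push_cast; ring
  simp_rw [hk, Finset.sum_sub_distrib, ← Finset.mul_sum, hr, mul_zero, sub_zero]

/-- A multiplicative relation of positive rationals is a linear relation of their logarithms. [folklore] -/
private theorem sum_log_eq_zero_of_prod_eq_one {κ : Type} [Fintype κ] {a : κ → ℚ} (ha : ∀ k, 0 < a k)
    {r : κ → ℤ} (hrel : ∏ k, a k ^ r k = 1) : ∑ k, (r k : ℝ) * Real.log (a k : ℝ) = 0 := by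
  have hcast : ((∏ k, a k ^ r k : ℚ) : ℝ) = ∏ k, ((a k : ℚ) : ℝ) ^ r k := by push_cast; rfl
  have h1 : Real.log (∏ k, ((a k : ℚ) : ℝ) ^ r k) = 0 := by rw [← hcast, hrel]; simp
  rw [Real.log_prod] at h1
  · simpa [Real.log_zpow] using h1
  · intro k _; exact zpow_ne_zero _ (by exact_mod_cast (ha k).ne')

/-- A linear relation of logarithms of positive rationals is a multiplicative relation. [folklore] -/
private theorem prod_eq_one_of_sum_log_eq_zero {κ : Type} [Fintype κ] {a : κ → ℚ} (ha : ∀ k, 0 < a k)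
    {μ : κ → ℤ} (hμ : ∑ k, (μ k : ℝ) * Real.log (a k : ℝ) = 0) : ∏ k, a k ^ μ k = 1 := by
  have hpos : (0 : ℝ) < ∏ k, ((a k : ℚ) : ℝ) ^ μ k :=
    Finset.prod_pos fun k _ => zpow_pos (by exact_mod_cast ha k) _
  have hlog : Real.log (∏ k, ((a k : ℚ) : ℝ) ^ μ k) = 0 := by
    rw [Real.log_prod]
    · simpa [Real.log_zpow] using hμ
    · intro k _; exact zpow_ne_zero _ (by exact_mod_cast (ha k).ne')
  have hone : ∏ k, ((a k : ℚ) : ℝ) ^ μ k = 1 := by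
    rcases Real.log_eq_zero.mp hlog with h | h | h
    · exact absurd h hpos.ne'
    · exact h
    · linarith
  have hcast : ((∏ k, a k ^ μ k : ℚ) : ℝ) = ∏ k, ((a k : ℚ) : ℝ) ^ μ k := by push_cast; rfl
  exact_mod_cast (hcast.trans hone)

/-- With `Rⱼ = 2 ∏_{l ∈ S∖j} 3A_l` (`j ∈ S`, `h(a_l) ≤ A_l`): `|2tⱼ| ≤ Rⱼ` and `|2tₖ| Aₖ ≤ Rⱼ Aⱼ` for
`k ∈ S`, for a relation with `|tₖ| ≤ ∏_{l∈S∖k} 2h(a_l)/log 2`. [cite: Matveev2000, §21 (p. 175)] -/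
private theorem relation_bounds {κ : Type} [Fintype κ] [DecidableEq κ] {a : κ → ℚ} {A : κ → ℝ}
    (hAh : ∀ k, logHeight₁ (a k) ≤ A k) {S : Finset κ} {t : κ → ℤ}
    (hbd : ∀ k ∈ S, (|t k| : ℝ) ≤ ∏ l ∈ S.erase k, (2 * logHeight₁ (a l) / Real.log 2))
    {j : κ} (hj : j ∈ S) :
    |((2 * t j : ℤ) : ℝ)| ≤ 2 * ∏ l ∈ S.erase j, (3 * A l) ∧
      ∀ k ∈ S, |((2 * t k : ℤ) : ℝ)| * A k ≤ (2 * ∏ l ∈ S.erase j, (3 * A l)) * A j := by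
  have hl2 : (2 : ℝ) / 3 ≤ Real.log 2 := by have := Real.log_two_gt_d9; linarith
  have hl0 : 0 < Real.log 2 := by linarith
  have hc0 : ∀ l, 0 ≤ 2 * logHeight₁ (a l) / Real.log 2 := fun l =>
    div_nonneg (mul_nonneg zero_le_two (Height.zero_le_logHeight₁ _)) hl0.le
  have hc3 : ∀ l, 2 * logHeight₁ (a l) / Real.log 2 ≤ 3 * A l := fun l => by
    rw [div_le_iff₀ hl0]; nlinarith [hAh l, Height.zero_le_logHeight₁ (a l)]
  have hA0 : ∀ l, 0 ≤ A l := fun l => le_trans (Height.zero_le_logHeight₁ _) (hAh l)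
  have hprod : ∀ k ∈ S, (|t k| : ℝ) ≤ ∏ l ∈ S.erase k, (3 * A l) := fun k hk =>
    le_trans (hbd k hk) (Finset.prod_le_prod (fun l _ => hc0 l) fun l _ => hc3 l)
  have habs : ∀ k, |((2 * t k : ℤ) : ℝ)| = 2 * |(t k : ℝ)| := by
    intro k; push_cast; rw [abs_mul, abs_two]
  refine ⟨?_, fun k hk => ?_⟩
  · rw [habs]; linarith [hprod j hj]
  · have e1 := Finset.mul_prod_erase S (fun l => 3 * A l) hk
    have e2 := Finset.mul_prod_erase S (fun l => 3 * A l) hj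
    rw [habs]
    calc 2 * |(t k : ℝ)| * A k ≤ 2 * (∏ l ∈ S.erase k, (3 * A l)) * A k := by
          have := hprod k hk; have := hA0 k; nlinarith
      _ = 2 / 3 * ((3 * A k) * ∏ l ∈ S.erase k, (3 * A l)) := by ring
      _ = 2 / 3 * ((3 * A j) * ∏ l ∈ S.erase j, (3 * A l)) := by rw [e1, e2]
      _ = (2 * ∏ l ∈ S.erase j, (3 * A l)) * A j := by ring

/-- Under the floor `A_l ≥ 1`: `∏_{l∈T} 3A_l ≤ 3^{#U} ∏_{l∈U} A_l` for `T ⊆ U`. [folklore] -/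
private theorem prod_three_mul_le {κ : Type} [DecidableEq κ] {A : κ → ℝ} (hA1 : ∀ k, (1 : ℝ) ≤ A k)
    {T U : Finset κ} (hTU : T ⊆ U) :
    ∏ l ∈ T, (3 * A l) ≤ (3 : ℝ) ^ U.card * ∏ l ∈ U, A l := by
  rw [← Finset.inter_eq_right.mpr hTU, ← Finset.prod_ite_mem U T (fun l => 3 * A l)]
  rw [← Finset.prod_const, ← Finset.prod_mul_distrib]
  refine Finset.prod_le_prod (fun l _ => ?_) (fun l _ => ?_)
  · split_ifs
    · linarith [hA1 l]
    · exact zero_le_one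
  · split_ifs
    · linarith [hA1 l]
    · linarith [hA1 l]

/-- `2 n 3^{n−1} ≤ 20ⁿ` in the form `2 (m+1) 3^m ≤ C^{m+1}` for `C ≥ 20`. [folklore] -/
private theorem two_mul_three_pow_le {C : ℝ} (hC : 20 ≤ C) (m : ℕ) :
    2 * ((m : ℝ) + 1) * (3 : ℝ) ^ m ≤ C ^ (m + 1) := by
  have h1 : ((m : ℝ) + 1) ≤ (2 : ℝ) ^ m := by
    have : (m + 1 : ℕ) ≤ 2 ^ m := Nat.succ_le_of_lt (Nat.lt_two_pow_self)
    exact_mod_cast this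
  have h3 : 0 ≤ (3 : ℝ) ^ m := by positivity
  have h6 : (2 : ℝ) ^ m * 3 ^ m = 6 ^ m := by rw [← mul_pow]; norm_num
  have hC6 : (6 : ℝ) ^ m ≤ C ^ m := pow_le_pow_left₀ (by norm_num) (by linarith) m
  have hCm : 0 ≤ C ^ m := by positivity
  calc 2 * ((m : ℝ) + 1) * 3 ^ m ≤ 2 * 2 ^ m * 3 ^ m := by nlinarith
    _ = 2 * 6 ^ m := by rw [mul_assoc, h6]
    _ ≤ C * C ^ m := by nlinarith
    _ = C ^ (m + 1) := by ring

/-- The dependence removal on a general finite index type (strong induction on its size).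
[cite: Matveev2000, §21 (pp. 173–176)] -/
private theorem dep_elim {C : ℝ} (hC : 20 ≤ C)
    (hcore : ∀ (κ : Type) [Fintype κ], ∀ (a : κ → ℚ) (b : κ → ℤ) (A : κ → ℝ) (B : ℝ),
      (∀ k, 0 < a k) → (∀ μ : κ → ℤ, ∏ k, a k ^ μ k = 1 → μ = 0) →
      (∀ k, logHeight₁ (a k) ≤ A k) → (∀ k, (1 : ℝ) ≤ A k) → b ≠ 0 → (∀ k, |(b k : ℝ)| ≤ B) →
      -(C ^ Fintype.card κ * (∏ k, A k) * Real.log (Real.exp 1 * B)) ≤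
        Real.log |∑ k, (b k : ℝ) * Real.log (a k : ℝ)|)
    (n : ℕ) :
    ∀ (κ : Type) [Fintype κ], Fintype.card κ = n → ∀ (a : κ → ℚ) (b : κ → ℤ) (A : κ → ℝ) (B : ℝ),
      (∀ k, 0 < a k) → (∀ k, logHeight₁ (a k) ≤ A k) → (∀ k, (1 : ℝ) ≤ A k) → (∀ k, |(b k : ℝ)| ≤ B) →
      ∑ k, (b k : ℝ) * Real.log (a k : ℝ) ≠ 0 →
      -(C ^ n * (∏ k, A k) * Real.log (Real.exp 1 * B)) ≤ Real.log |∑ k, (b k : ℝ) * Real.log (a k : ℝ)| := by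
  induction n using Nat.strong_induction_on with
  | _ n IH =>
  intro κ _ hcard a b A B ha hAh hA1 hbB hΛ
  classical
  have hb : b ≠ 0 := by rintro rfl; exact hΛ (by simp)
  obtain ⟨k₁, hk₁⟩ : ∃ k, b k ≠ 0 := by by_contra h; push Not at h; exact hb (funext h)
  obtain ⟨m, rfl⟩ : ∃ m, n = m + 1 :=
    ⟨n - 1, by have : 0 < n := hcard ▸ Fintype.card_pos_iff.mpr ⟨k₁⟩; omega⟩
  have hA0 : ∀ k, 0 < A k := fun k => lt_of_lt_of_le one_pos (hA1 k)
  have hB1 : 1 ≤ B := by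
    have h1 : (1 : ℝ) ≤ |(b k₁ : ℝ)| := by rw [← Int.cast_abs]; exact_mod_cast Int.one_le_abs hk₁
    exact h1.trans (hbB k₁)
  have hB0 : 0 < B := by linarith
  set L := Real.log (Real.exp 1 * B) with hL
  have hE := Real.exp_pos 1
  have hLB : L = 1 + Real.log B := by rw [hL, Real.log_mul hE.ne' hB0.ne', Real.log_exp]
  have hL1 : 1 ≤ L := by rw [hLB]; linarith [Real.log_nonneg hB1]
  have hC0 : 0 < C := by linarith
  obtain ⟨ks, -, hks⟩ := Finset.exists_max_image univ A (univ_nonempty_iff.mpr ⟨k₁⟩)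
  have hks' : ∀ k, A k ≤ A ks := fun k => hks k (mem_univ k)
  set P := ∏ k ∈ univ.erase ks, A k with hP
  have hP1 : 1 ≤ P := by
    rw [hP, ← Finset.prod_const_one (s := univ.erase ks)]
    exact Finset.prod_le_prod (fun _ _ => zero_le_one) fun k _ => hA1 k
  have hsplit : ∏ k, A k = A ks * P := (Finset.mul_prod_erase univ A (mem_univ ks)).symm
  -- (L) Liouville: `log|Λ| ≥ −∑|bₖ|h(aₖ) ≥ −B (m+1) A_{ks}`
  have hLiou : -(B * (((m : ℝ) + 1) * A ks)) ≤ Real.log |∑ k, (b k : ℝ) * Real.log (a k : ℝ)| := by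
    have h1 := Matveev2000Thm22OfThm21.log_abs_linearForm_ge a b ha hΛ
    have h2 : ∑ k, |(b k : ℝ)| * logHeight₁ (a k) ≤ ∑ _k : κ, B * A ks := by
      refine Finset.sum_le_sum fun k _ => ?_
      exact mul_le_mul (hbB k) ((hAh k).trans (hks' k)) (Height.zero_le_logHeight₁ _) hB0.le
    rw [Finset.sum_const, card_univ, hcard, nsmul_eq_mul] at h2
    push_cast at h2
    linarith
  by_cases hLcase : B * (((m : ℝ) + 1) * A ks) ≤ C ^ (m + 1) * (∏ k, A k) * L
  · linarith
  -- (†) `C^{m+1} P L < (m+1) B`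
  have hdag : C ^ (m + 1) * P * L < ((m : ℝ) + 1) * B := by
    push Not at hLcase
    rw [hsplit] at hLcase
    have : (C ^ (m + 1) * P * L) * A ks < (((m : ℝ) + 1) * B) * A ks := by nlinarith
    exact lt_of_mul_lt_mul_right this (hA0 ks).le
  by_cases hind : ∀ μ : κ → ℤ, ∏ k, a k ^ μ k = 1 → μ = 0
  · -- independent: the core
    have h := hcore κ a b A B ha hind hAh hA1 hb hbB
    rwa [hcard] at h
  -- dependent: a small relation on a minimal support `S`
  push Not at hind
  obtain ⟨μ, hμ, hμ0⟩ := hind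
  obtain ⟨S, t, hSne, hsupp, htrel, hbd⟩ := exists_small_mult_relation (fun k => (ha k).ne') hμ0 hμ
  have hrsum := sum_log_eq_zero_of_prod_eq_one ha htrel
  -- the index to eliminate: `ks` if it is in `S`, any index of `S` otherwise
  obtain ⟨j, hj, hT⟩ : ∃ j ∈ S, S.erase j ⊆ univ.erase ks := by
    by_cases hks : ks ∈ S
    · exact ⟨ks, hks, Finset.erase_subset_erase ks (subset_univ S)⟩
    · obtain ⟨j, hj⟩ := hSne
      refine ⟨j, hj, fun l hl => Finset.mem_erase.mpr ⟨fun h => hks (h ▸ (Finset.mem_erase.mp hl).2),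
        mem_univ l⟩⟩
  have htj : t j ≠ 0 := (hsupp j).mpr hj
  have hrj : (2 * t j : ℤ) ≠ 0 := mul_ne_zero two_ne_zero htj
  have hrj' : ((2 * t j : ℤ) : ℝ) ≠ 0 := by exact_mod_cast hrj
  -- the size of the relation: `R = 2 ∏_{S∖j} 3A ≤ 2·3^m·P < B`
  set R := 2 * ∏ l ∈ S.erase j, (3 * A l) with hR
  obtain ⟨hRj, hRk⟩ := relation_bounds hAh hbd hj
  have hU : (univ.erase ks).card = m := by
    rw [Finset.card_erase_of_mem (mem_univ ks), card_univ, hcard]; rfl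
  have hR1 : 1 ≤ R := by
    have : (1 : ℝ) ≤ |((2 * t j : ℤ) : ℝ)| := by rw [← Int.cast_abs]; exact_mod_cast Int.one_le_abs hrj
    linarith
  have hRB : R < B := by
    have h1 : ∏ l ∈ S.erase j, (3 * A l) ≤ (3 : ℝ) ^ m * P := by
      have := prod_three_mul_le hA1 hT; rwa [hU] at this
    have h2 : 2 * ((m : ℝ) + 1) * (3 : ℝ) ^ m ≤ C ^ (m + 1) := two_mul_three_pow_le hC m
    have h3m : 0 ≤ (3 : ℝ) ^ m := by positivity
    -- `R C^{m+1} ≤ 2·3^m P C^{m+1} ≤ 2·3^m (m+1) B / L ≤ C^{m+1} B` (using `L ≥ 1`)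
    have h3 : R * (C ^ (m + 1) * L) < B * (C ^ (m + 1) * L) := by
      calc R * (C ^ (m + 1) * L) ≤ (2 * ((3 : ℝ) ^ m * P)) * (C ^ (m + 1) * L) :=
            mul_le_mul_of_nonneg_right (by rw [hR]; linarith) (by positivity)
        _ = 2 * (3 : ℝ) ^ m * (C ^ (m + 1) * P * L) := by ring
        _ < 2 * (3 : ℝ) ^ m * (((m : ℝ) + 1) * B) := mul_lt_mul_of_pos_left hdag (by positivity)
        _ = (2 * ((m : ℝ) + 1) * 3 ^ m) * B := by ring
        _ ≤ C ^ (m + 1) * B := mul_le_mul_of_nonneg_right h2 hB0.le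
        _ = B * (C ^ (m + 1) * 1) := by ring
        _ ≤ B * (C ^ (m + 1) * L) :=
            mul_le_mul_of_nonneg_left (mul_le_mul_of_nonneg_left hL1 (by positivity)) hB0.le
    exact lt_of_mul_lt_mul_right h3 (by positivity)
  -- the new coefficients `b'ₖ = 2tⱼ bₖ − 2tₖ bⱼ` are `≤ 2 R Aⱼ B`
  set B' := B * (2 * R * A j) with hB'
  have hAj := hA1 j
  have hbB' : ∀ k : {k // k ≠ j}, |((2 * t j * b k.val - 2 * t k.val * b j : ℤ) : ℝ)| ≤ B' := by
    intro k
    have h1 : |((2 * t j : ℤ) : ℝ)| * |(b k.val : ℝ)| ≤ R * B :=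
      mul_le_mul hRj (hbB k.val) (abs_nonneg _) (by linarith)
    have h2 : |((2 * t k.val : ℤ) : ℝ)| * |(b j : ℝ)| ≤ R * A j * B := by
      by_cases hkS : k.val ∈ S
      · have h3 : |((2 * t k.val : ℤ) : ℝ)| ≤ R * A j := by
          have h4 := hRk k.val hkS
          have h5 : |((2 * t k.val : ℤ) : ℝ)| * 1 ≤ |((2 * t k.val : ℤ) : ℝ)| * A k.val :=
            mul_le_mul_of_nonneg_left (hA1 _) (abs_nonneg _)
          linarith
        exact mul_le_mul h3 (hbB j) (abs_nonneg _) (by nlinarith)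
      · have htk : t k.val = 0 := by by_contra h; exact hkS ((hsupp _).mp h)
        rw [htk, mul_zero, Int.cast_zero, abs_zero, zero_mul]
        exact mul_nonneg (mul_nonneg (by linarith) (by linarith)) hB0.le
    calc |((2 * t j * b k.val - 2 * t k.val * b j : ℤ) : ℝ)|
        = |((2 * t j : ℤ) : ℝ) * (b k.val : ℝ) - ((2 * t k.val : ℤ) : ℝ) * (b j : ℝ)| := by
          push_cast; ring_nf
      _ ≤ |((2 * t j : ℤ) : ℝ) * (b k.val : ℝ)| + |((2 * t k.val : ℤ) : ℝ) * (b j : ℝ)| := abs_sub _ _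
      _ = |((2 * t j : ℤ) : ℝ)| * |(b k.val : ℝ)| + |((2 * t k.val : ℤ) : ℝ)| * |(b j : ℝ)| := by
          rw [abs_mul, abs_mul]
      _ ≤ R * B + R * A j * B := add_le_add h1 h2
      _ ≤ B' := by
          have h3 : R * B * 1 ≤ R * B * A j :=
            mul_le_mul_of_nonneg_left hAj (mul_nonneg (by linarith) hB0.le)
          rw [hB']; linarith
  have hΛ' : ∑ k : {k // k ≠ j}, ((2 * t j * b k.val - 2 * t k.val * b j : ℤ) : ℝ) *
      Real.log (a k.val : ℝ) = ((2 * t j : ℤ) : ℝ) * ∑ k, (b k : ℝ) * Real.log (a k : ℝ) :=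
    sum_elim a b (fun k => 2 * t k) j hrsum
  have hΛ'ne : ∑ k : {k // k ≠ j}, ((2 * t j * b k.val - 2 * t k.val * b j : ℤ) : ℝ) *
      Real.log (a k.val : ℝ) ≠ 0 := by rw [hΛ']; exact mul_ne_zero hrj' hΛ
  have hcard' : Fintype.card {k // k ≠ j} = m := card_subtype_ne j hcard
  have hI := IH m (lt_add_one m) {k // k ≠ j} hcard' (fun k => a k.val)
    (fun k => 2 * t j * b k.val - 2 * t k.val * b j) (fun k => A k.val) B' (fun k => ha k.val)
    (fun k => hAh k.val) (fun k => hA1 k.val) hbB' hΛ'ne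
  rw [hΛ', prod_subtype_ne j A, abs_mul, Real.log_mul (abs_ne_zero.mpr hrj') (abs_ne_zero.mpr hΛ)] at hI
  set Pj := ∏ k ∈ univ.erase j, A k with hPj
  have hPj1 : 1 ≤ Pj := by
    rw [hPj, ← Finset.prod_const_one (s := univ.erase j)]
    exact Finset.prod_le_prod (fun _ _ => zero_le_one) fun k _ => hA1 k
  have hsplitj : ∏ k, A k = A j * Pj := (Finset.mul_prod_erase univ A (mem_univ j)).symm
  -- `log|2tⱼ| ≤ log R ≤ log B = L − 1`; `log(eB') = L + log(2R) + log Aⱼ ≤ 2L + (Aⱼ − 1)`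
  have hlogr : Real.log |((2 * t j : ℤ) : ℝ)| ≤ L - 1 := by
    have h1 := Real.log_le_log (abs_pos.mpr hrj') (by linarith : |((2 * t j : ℤ) : ℝ)| ≤ B)
    linarith
  have hL' : Real.log (Real.exp 1 * B') ≤ 2 * L + (A j - 1) := by
    have hR2 : (0 : ℝ) < 2 * R := by linarith
    rw [hB', show Real.exp 1 * (B * (2 * R * A j)) = (Real.exp 1 * B) * ((2 * R) * A j) by ring,
      Real.log_mul (x := Real.exp 1 * B) (y := 2 * R * A j) (mul_pos hE hB0).ne'
        (mul_pos hR2 (hA0 j)).ne',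
      Real.log_mul (x := 2 * R) (y := A j) hR2.ne' (hA0 j).ne']
    have h1 : Real.log (2 * R) ≤ Real.log (2 * B) := Real.log_le_log (by linarith) (by linarith)
    have h2 : Real.log (2 * B) = Real.log 2 + Real.log B := Real.log_mul (by norm_num) hB0.ne'
    have h3 : Real.log 2 ≤ 1 := by have := Real.log_two_lt_d9; linarith
    have h4 : Real.log (A j) ≤ A j - 1 := Real.log_le_sub_one_of_pos (hA0 j)
    linarith
  -- numerics: `C^m Pj (2L + Aⱼ − 1) + (L − 1) ≤ C^{m+1} Aⱼ Pj L` for `C ≥ 20`, `Aⱼ, Pj, L ≥ 1`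
  rw [hsplitj]
  set X := C ^ m * Pj with hX
  have hX1 : 1 ≤ X := one_le_mul_of_one_le_of_one_le (one_le_pow₀ (by linarith)) hPj1
  obtain ⟨hX0, hL0⟩ : 0 ≤ X ∧ 0 ≤ L := ⟨by linarith, by linarith⟩
  have h1 : X * Real.log (Real.exp 1 * B') ≤ X * (2 * L + (A j - 1)) :=
    mul_le_mul_of_nonneg_left hL' hX0
  have h2 : 2 * L + (A j - 1) ≤ L * (1 + A j) := by
    nlinarith [mul_nonneg (sub_nonneg.mpr hL1) (sub_nonneg.mpr hAj)]
  have h3 : X * (2 * L + (A j - 1)) ≤ X * (L * (1 + A j)) := mul_le_mul_of_nonneg_left h2 hX0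
  have h4 : 1 * L ≤ X * L := mul_le_mul_of_nonneg_right hX1 hL0
  have h5 : 2 + A j ≤ C * A j := by
    nlinarith [mul_le_mul_of_nonneg_right (show (19 : ℝ) ≤ C - 1 by linarith)
      (show (0 : ℝ) ≤ A j by linarith)]
  have h6 : X * L * (2 + A j) ≤ X * L * (C * A j) :=
    mul_le_mul_of_nonneg_left h5 (mul_nonneg hX0 hL0)
  have h7 : C ^ (m + 1) * (A j * Pj) * L = X * L * (C * A j) := by rw [hX]; ring
  rw [h7]
  linarith

/-- From the `Fin r`-indexed core to every finite index type, constant `max |c| 20`. [folklore] -/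
private theorem core_fintype {c : ℝ}
    (hc : ∀ (r : ℕ) (a : Fin r → ℚ) (b : Fin r → ℤ) (A : Fin r → ℝ) (B : ℝ),
      (∀ i, 0 < a i) → (∀ μ : Fin r → ℤ, ∏ i, a i ^ μ i = 1 → μ = 0) →
      (∀ i, Height.logHeight₁ (a i) ≤ A i) → (∀ i, 1 ≤ A i) → b ≠ 0 → (∀ i, (|b i| : ℝ) ≤ B) →
      -(c ^ r * (∏ i, A i) * Real.log (Real.exp 1 * B)) ≤ Real.log |∑ i, (b i : ℝ) * Real.log (a i : ℝ)|)
    (κ : Type) [Fintype κ] (a : κ → ℚ) (b : κ → ℤ) (A : κ → ℝ) (B : ℝ) (ha : ∀ k, 0 < a k)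
    (hind : ∀ μ : κ → ℤ, ∏ k, a k ^ μ k = 1 → μ = 0) (hAh : ∀ k, logHeight₁ (a k) ≤ A k)
    (hA1 : ∀ k, (1 : ℝ) ≤ A k) (hb : b ≠ 0) (hbB : ∀ k, |(b k : ℝ)| ≤ B) :
    -((max |c| 20) ^ Fintype.card κ * (∏ k, A k) * Real.log (Real.exp 1 * B)) ≤
      Real.log |∑ k, (b k : ℝ) * Real.log (a k : ℝ)| := by
  set r := Fintype.card κ with hr
  set e : κ ≃ Fin r := Fintype.equivFin κ with he
  have hind' : ∀ μ : Fin r → ℤ, ∏ i, (a (e.symm i)) ^ μ i = 1 → μ = 0 := by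
    intro μ hμ
    have h1 : ∏ k, a k ^ μ (e k) = 1 := by
      rw [← hμ]; exact (Fintype.prod_equiv e _ _ fun k => by simp)
    have h2 := hind (fun k => μ (e k)) h1
    funext i
    have := congr_fun h2 (e.symm i)
    simpa using this
  obtain ⟨k₁, hk₁⟩ : ∃ k, b k ≠ 0 := by by_contra h; push Not at h; exact hb (funext h)
  have hb' : (fun i => b (e.symm i)) ≠ 0 := by
    intro h; apply hk₁; have := congr_fun h (e k₁); simpa using this
  have h := hc r (fun i => a (e.symm i)) (fun i => b (e.symm i)) (fun i => A (e.symm i)) B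
    (fun i => ha _) hind' (fun i => hAh _) (fun i => hA1 _) hb' (fun i => hbB _)
  rw [Fintype.prod_equiv e.symm (fun i => A (e.symm i)) A fun i => rfl, Fintype.sum_equiv e.symm
    (fun i => (b (e.symm i) : ℝ) * Real.log (a (e.symm i) : ℝ)) (fun k => (b k : ℝ) * Real.log (a k : ℝ))
    fun i => rfl] at h
  -- `c^r ≤ |c|^r ≤ (max |c| 20)^r`
  have hB1 : 1 ≤ B := by
    have h1 : (1 : ℝ) ≤ |(b k₁ : ℝ)| := by rw [← Int.cast_abs]; exact_mod_cast Int.one_le_abs hk₁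
    exact h1.trans (hbB k₁)
  have hL0 : 0 ≤ Real.log (Real.exp 1 * B) := Real.log_nonneg (by nlinarith [Real.exp_one_gt_d9])
  have hP0 : 0 ≤ ∏ k, A k := Finset.prod_nonneg fun k _ => (lt_of_lt_of_le one_pos (hA1 k)).le
  have hpow : c ^ r ≤ (max |c| 20) ^ r :=
    le_trans (le_abs_self _) (by rw [abs_pow]; exact pow_le_pow_left₀ (abs_nonneg c) (le_max_left _ _) r)
  have : c ^ r * (∏ k, A k) * Real.log (Real.exp 1 * B) ≤
      (max |c| 20) ^ r * (∏ k, A k) * Real.log (Real.exp 1 * B) :=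
    mul_le_mul_of_nonneg_right (mul_le_mul_of_nonneg_right hpow hP0) hL0
  linarith

end ArchShapeDepElim

open ArchShapeDepElim in
/-- **Dependence removal for the archimedean shape bound over `ℚ`**: the hypothesis is the planner's text
of `ArchCoreRat` (route draft `YuMatveevShapeRat`) verbatim; the conclusion is the same bound, constant
`max |c| 20`, for all positive rationals with non-zero linear form. [cite: Matveev2000, §21 (pp. 173–176)] -/
theorem archShape_dep_of_indep
    (h : ∃ c : ℝ, ∀ (r : ℕ) (a : Fin r → ℚ) (b : Fin r → ℤ) (A : Fin r → ℝ) (B : ℝ),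
      (∀ i, 0 < a i) →
      (∀ μ : Fin r → ℤ, ∏ i, a i ^ μ i = 1 → μ = 0) →
      (∀ i, Height.logHeight₁ (a i) ≤ A i) → (∀ i, 1 ≤ A i) →
      b ≠ 0 → (∀ i, (|b i| : ℝ) ≤ B) →
      -(c ^ r * (∏ i, A i) * Real.log (Real.exp 1 * B)) ≤
        Real.log |∑ i, (b i : ℝ) * Real.log (a i : ℝ)|) :
    ∃ c : ℝ, ∀ (r : ℕ) (a : Fin r → ℚ) (b : Fin r → ℤ) (A : Fin r → ℝ) (B : ℝ),
      (∀ i, 0 < a i) →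
      (∀ i, Height.logHeight₁ (a i) ≤ A i) → (∀ i, 1 ≤ A i) →
      (∀ i, (|b i| : ℝ) ≤ B) →
      ∑ i, (b i : ℝ) * Real.log (a i : ℝ) ≠ 0 →
      -(c ^ r * (∏ i, A i) * Real.log (Real.exp 1 * B)) ≤
        Real.log |∑ i, (b i : ℝ) * Real.log (a i : ℝ)| := by
  obtain ⟨c, hc⟩ := h
  exact ⟨max |c| 20, fun r a b A B ha hAh hA1 hbB hΛ =>
    dep_elim (C := max |c| 20) (le_max_right _ _) (core_fintype hc) r (Fin r) (by simp) a b A B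
      ha hAh hA1 hbB hΛ⟩

end Summit.ABC.StewartYu

end
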